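import Summits.RiemannHypothesis.RiemannHypothesis.Theses.SpectralTrace
import HarnessLib

/-!
# RiemannHypothesis / SpectralTrace — the glue item `WindowPrime2ToArch`

Route `RiemannHypothesis/SpectralTrace`, item stmt-RiemannHypothesis-14738 (`WindowPrime2ToArch`,
support/glue, rank 9):

  `WindowTracePrime2 → WindowTraceArch`.

Window monotonicity for the window-trace ladder: the first arithmetic rung `Trace(log 3)`
(`WindowTracePrime2`) implies the archimedean seed `Trace(log 2)` (`WindowTraceArch`).
A Weil test supported in `[-log 2, log 2]` is supported in `[-log 3, log 3]` because
`log 2 ≤ log 3` (`Real.log_le_log`, `Set.Icc_subset_Icc`), so a rung-3 family `⟨ι, γ⟩` serves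
verbatim as a rung-2 family. (Same argument as step (2) of the route's deciding theorem `closes`
and as the refuter's `windowTrace_mono` evidence on stmt-RiemannHypothesis-11196.)
-/

-- D-0017: single-problem summit ⇒ namespace `Summit.RiemannHypothesis.RiemannHypothesis.…` by design
-- (the Summits library sets `weak.linter.dupNamespace = false`; repeated here for standalone checks).
set_option linter.dupNamespace false

namespace Summit.RiemannHypothesis.RiemannHypothesis.Theorems

open Summit.RiemannHypothesis.RiemannHypothesis.Theses.SpectralTrace

/-- Window monotonicity `log 2 ≤ log 3`: the test window `[-log 2, log 2]` sits inside
`[-log 3, log 3]`. [folklore] -/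
theorem windowPrime2ToArch_Icc_subset :
    Set.Icc (-Real.log 2) (Real.log 2) ⊆ Set.Icc (-Real.log 3) (Real.log 3) := by
  have h : Real.log 2 ≤ Real.log 3 := Real.log_le_log two_pos (by norm_num)
  exact Set.Icc_subset_Icc (neg_le_neg h) h

/-- **Glue `WindowPrime2ToArch`** (item stmt-RiemannHypothesis-14738, proved outright): the rung
`Trace(log 3)` implies the seed `Trace(log 2)` — every Weil test supported in `[-log 2, log 2]` is
supported in `[-log 3, log 3]` (`windowPrime2ToArch_Icc_subset`), so the rung-3 family reproduces
`weilFunctional` on it verbatim. [folklore] -/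
theorem windowPrime2ToArch_proof : WindowPrime2ToArch := by
  unfold WindowPrime2ToArch WindowTracePrime2 WindowTraceArch
  rintro ⟨ι, γ, h⟩
  exact ⟨ι, γ, fun g hg hs => h g hg (hs.trans windowPrime2ToArch_Icc_subset)⟩

end Summit.RiemannHypothesis.RiemannHypothesis.Theorems
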